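import Summits.KontsevichZagierPeriods.KontsevichZagierPeriods.Theorems.RootDecompRelativeModAbsoluteCircleLogP8

/-! # `RootDecompRelativeModAbsoluteCircleLogP9` — part 9/11 of the mechanical ≤400-line split of `CircleLogTranscendence_landing.lean` (sha256 022159109aaffa3a…)
Source: decomp-kz lens-3 g13 `CircleLogTranscendence_v9.lean` (HOME/decomp-kz-lens-3/g13/, sha256 afb45a43…; critic g5-45/60/65/68/69 CLEARED FOR LANDING --supports 30572 (§4 defs, §8–§10 CircleLogStructureAt 0 from the tree's baker_decomposition_complex, constant-data cells every n, §16–§23 descent ingredients); landed by census-1 g9 over the landed CylLogSplitP52 (BLOCK G13): the duplicate def CircleLogStructure is dropped in favour of the landed one).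
Split by census-1 g9 `gen/splitlean.py`: scopes re-opened with their `open`/`variable`/`set_option` context; mathematics and declaration order unchanged. -/

noncomputable section
open Set MeasureTheory Filter Topology
open scoped BigOperators
open Literature.NumberTheory.Transcendental Literature.ModelTheory.ExponentialFields
namespace Summit.KontsevichZagierPeriods.RootDecompRelativeModAbsolute.Rung30571.RegularisedLogLayer.CylLog.Leaf
namespace G13

/-- **Projectively constant coefficients** (case (a) of the descent step, `DESCENT-blueprint.md`): if on the open `ℚ`-sa `U` the coefficient
vector is a nowhere-vanishing `ℚ`-sa function `φ` times a CONSTANT vector — `hᵢ = φ·cᵢ`, `pⱼ = φ·dⱼ` — then the structure conclusion holds for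
`U` (divide by `φ`, §17, multiply the coefficient functions back by `φ`). -/
theorem circleLogStructure_projConstCoeff {n k l : ℕ} {U : Set (Fin n → ℝ)} (hU : IsSemialgebraic ℚ U) (hUo : IsOpen U)
    {h W : Fin k → (Fin n → ℝ) → ℝ} {p u : Fin l → (Fin n → ℝ) → ℝ} {g : (Fin n → ℝ) → ℝ}
    (hh : ∀ i, IsSemialgebraicFunOn ℚ U (h i)) (hW : ∀ i, IsSemialgebraicFunOn ℚ U (W i))
    (hWc : ∀ i, ContinuousOn (W i) U) (hW0 : ∀ i, ∀ x ∈ U, 0 < W i x)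
    (hp : ∀ j, IsSemialgebraicFunOn ℚ U (p j)) (hu : ∀ j, IsSemialgebraicFunOn ℚ U (u j))
    (huc : ∀ j, ContinuousOn (u j) U) (hg : IsSemialgebraicFunOn ℚ U g)
    {φ : (Fin n → ℝ) → ℝ} (hφ : IsSemialgebraicFunOn ℚ U φ) (hφ0 : ∀ x ∈ U, φ x ≠ 0)
    (c : Fin k → ℝ) (d : Fin l → ℝ) (hhφ : ∀ i, ∀ x ∈ U, h i x = φ x * c i) (hpφ : ∀ j, ∀ x ∈ U, p j x = φ x * d j)
    (hid : ∀ x ∈ U, ∑ i, h i x * Real.log (W i x) + ∑ j, p j x * Real.arctan (u j x) = g x) :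
    ∃ (N : ℕ) (C : Fin N → Set (Fin n → ℝ)),
      (∀ c, IsSemialgebraic ℚ (C c) ∧ IsOpen (C c) ∧ C c ⊆ U) ∧
      Pairwise (Function.onFun Disjoint C) ∧ volume (U \ ⋃ c, C c) = 0 ∧
      ∀ c, (∀ x ∈ C c, g x = 0) ∧
        ∃ (R : ℕ) (f : Fin R → Fin k → ℤ) (q : Fin R → (Fin n → ℝ) → ℝ)
          (S : ℕ) (f' : Fin S → Fin l → ℤ) (m : Fin S → ℚ) (q' : Fin S → (Fin n → ℝ) → ℝ),
          (∀ r, IsSemialgebraicFunOn ℚ (C c) (q r)) ∧ (∀ r, ∀ x ∈ C c, ∏ i, W i x ^ (f r i) = 1) ∧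
          (∀ i, ∀ x ∈ C c, h i x = ∑ r, q r x * (f r i : ℝ)) ∧
          (∀ s, IsSemialgebraicFunOn ℚ (C c) (q' s)) ∧
          (∀ s, ∀ x ∈ C c, ∑ j, (f' s j : ℝ) * Real.arctan (u j x) = (m s : ℝ) * Real.pi) ∧
          (∀ x ∈ C c, ∑ s, q' s x * (m s : ℝ) = 0) ∧
          (∀ j, ∀ x ∈ C c, p j x = ∑ s, q' s x * (f' s j : ℝ)) := by
  classical
  -- divide by `φ`
  have hh' : ∀ i, IsSemialgebraicFunOn ℚ U (fun x => h i x / φ x) := fun i => (hh i).div hφ hφ0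
  have hp' : ∀ j, IsSemialgebraicFunOn ℚ U (fun x => p j x / φ x) := fun j => (hp j).div hφ hφ0
  have hg' : IsSemialgebraicFunOn ℚ U (fun x => g x / φ x) := hg.div hφ hφ0
  have hhc : ∀ i, ∀ x ∈ U, ∀ y ∈ U, h i x / φ x = h i y / φ y := fun i x hx y hy => by
    rw [hhφ i x hx, hhφ i y hy, mul_div_cancel_left₀ _ (hφ0 x hx), mul_div_cancel_left₀ _ (hφ0 y hy)]
  have hpc : ∀ j, ∀ x ∈ U, ∀ y ∈ U, p j x / φ x = p j y / φ y := fun j x hx y hy => by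
    rw [hpφ j x hx, hpφ j y hy, mul_div_cancel_left₀ _ (hφ0 x hx), mul_div_cancel_left₀ _ (hφ0 y hy)]
  have hid' : ∀ x ∈ U, ∑ i, h i x / φ x * Real.log (W i x) + ∑ j, p j x / φ x * Real.arctan (u j x) =
      g x / φ x := by
    intro x hx
    rw [← hid x hx, add_div, Finset.sum_div, Finset.sum_div]
    congr 1
    · exact Finset.sum_congr rfl fun i _ => by ring
    · exact Finset.sum_congr rfl fun j _ => by ring
  obtain ⟨N, C, hC, hdisj, hnull, hcell⟩ := circleLogStructure_constCoeff hU hUo hh' hW hWc hW0 hp' hu huc hg' hhc hpc hid'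
  refine ⟨N, C, hC, hdisj, hnull, fun c₀ => ?_⟩
  obtain ⟨hg0, R, f, q, S, f', m, q', hq, hrel, hhq, hq', hrel', hbud, hpq⟩ := hcell c₀
  have hCU : C c₀ ⊆ U := (hC c₀).2.2
  have hφC : IsSemialgebraicFunOn ℚ (C c₀) φ := hφ.mono hCU (hC c₀).1
  refine ⟨fun x hx => ?_, R, f, fun r x => φ x * q r x, S, f', m, fun s x => φ x * q' s x, fun r => ?_, hrel,
    fun i x hx => ?_, fun s => ?_, hrel', fun x hx => ?_, fun j x hx => ?_⟩
  · have := hg0 x hx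
    rcases div_eq_zero_iff.mp this with h0 | h0
    · exact h0
    · exact absurd h0 (hφ0 x (hCU hx))
  · exact (IsSemialgebraicFunOn.mul_holds hφC (hq r)).congr fun x _ => by simp only [Pi.mul_apply]
  · have e := hhq i x hx
    rw [div_eq_iff (hφ0 x (hCU hx))] at e
    rw [e, Finset.sum_mul]
    exact Finset.sum_congr rfl fun r _ => by ring
  · exact (IsSemialgebraicFunOn.mul_holds hφC (hq' s)).congr fun x _ => by simp only [Pi.mul_apply]
  · have e := hbud x hx
    calc ∑ s, φ x * q' s x * (m s : ℝ) = φ x * ∑ s, q' s x * (m s : ℝ) := by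
          rw [Finset.mul_sum]; exact Finset.sum_congr rfl fun s _ => by ring
      _ = 0 := by rw [e, mul_zero]
  · have e := hpq j x hx
    rw [div_eq_iff (hφ0 x (hCU hx))] at e
    rw [e, Finset.sum_mul]
    exact Finset.sum_congr rfl fun s _ => by ring

/-! ### §19 Localisation: the structure conclusion is local for a.e. open sa partitions (every `n`) — PROVED

The bookkeeping step used at every level of the descent (`DESCENT-blueprint.md`, step 5): if `G ⊆ U` has null complement in `U`, `T` is an
a.e. partition of `G`, and the structure conclusion holds on every `T b`, then it holds on `U` (flatten the two levels of cells). -/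

/-- **Localisation of the structure conclusion** along an a.e. partition (pure bookkeeping, every dimension). -/
theorem circleLogStructure_of_cells {n k l : ℕ} {U G : Set (Fin n → ℝ)} (hGU : G ⊆ U) (hUG : volume (U \ G) = 0)
    {h W : Fin k → (Fin n → ℝ) → ℝ} {p u : Fin l → (Fin n → ℝ) → ℝ} {g : (Fin n → ℝ) → ℝ}
    {B : ℕ} (T : Fin B → Set (Fin n → ℝ)) (hTG : ∀ b, T b ⊆ G) (hTd : Pairwise (Function.onFun Disjoint T))
    (hTn : volume (G \ ⋃ b, T b) = 0)
    (hcell : ∀ b, ∃ (N : ℕ) (C : Fin N → Set (Fin n → ℝ)),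
      (∀ c, IsSemialgebraic ℚ (C c) ∧ IsOpen (C c) ∧ C c ⊆ T b) ∧
      Pairwise (Function.onFun Disjoint C) ∧ volume (T b \ ⋃ c, C c) = 0 ∧
      ∀ c, (∀ x ∈ C c, g x = 0) ∧
        ∃ (R : ℕ) (f : Fin R → Fin k → ℤ) (q : Fin R → (Fin n → ℝ) → ℝ)
          (S : ℕ) (f' : Fin S → Fin l → ℤ) (m : Fin S → ℚ) (q' : Fin S → (Fin n → ℝ) → ℝ),
          (∀ r, IsSemialgebraicFunOn ℚ (C c) (q r)) ∧ (∀ r, ∀ x ∈ C c, ∏ i, W i x ^ (f r i) = 1) ∧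
          (∀ i, ∀ x ∈ C c, h i x = ∑ r, q r x * (f r i : ℝ)) ∧
          (∀ s, IsSemialgebraicFunOn ℚ (C c) (q' s)) ∧
          (∀ s, ∀ x ∈ C c, ∑ j, (f' s j : ℝ) * Real.arctan (u j x) = (m s : ℝ) * Real.pi) ∧
          (∀ x ∈ C c, ∑ s, q' s x * (m s : ℝ) = 0) ∧
          (∀ j, ∀ x ∈ C c, p j x = ∑ s, q' s x * (f' s j : ℝ))) :
    ∃ (N : ℕ) (C : Fin N → Set (Fin n → ℝ)),
      (∀ c, IsSemialgebraic ℚ (C c) ∧ IsOpen (C c) ∧ C c ⊆ U) ∧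
      Pairwise (Function.onFun Disjoint C) ∧ volume (U \ ⋃ c, C c) = 0 ∧
      ∀ c, (∀ x ∈ C c, g x = 0) ∧
        ∃ (R : ℕ) (f : Fin R → Fin k → ℤ) (q : Fin R → (Fin n → ℝ) → ℝ)
          (S : ℕ) (f' : Fin S → Fin l → ℤ) (m : Fin S → ℚ) (q' : Fin S → (Fin n → ℝ) → ℝ),
          (∀ r, IsSemialgebraicFunOn ℚ (C c) (q r)) ∧ (∀ r, ∀ x ∈ C c, ∏ i, W i x ^ (f r i) = 1) ∧
          (∀ i, ∀ x ∈ C c, h i x = ∑ r, q r x * (f r i : ℝ)) ∧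
          (∀ s, IsSemialgebraicFunOn ℚ (C c) (q' s)) ∧
          (∀ s, ∀ x ∈ C c, ∑ j, (f' s j : ℝ) * Real.arctan (u j x) = (m s : ℝ) * Real.pi) ∧
          (∀ x ∈ C c, ∑ s, q' s x * (m s : ℝ) = 0) ∧
          (∀ j, ∀ x ∈ C c, p j x = ∑ s, q' s x * (f' s j : ℝ)) := by
  classical
  choose N C hC hCd hCn hdata using hcell
  obtain ⟨M, E, hE, hEd, hEn⟩ := exists_flatten_partition T hTG hTd hTn N C
    (fun b c => (hC b c).2.2) hCd hCn
    (P := fun S => IsSemialgebraic ℚ S ∧ IsOpen S ∧ ((∀ x ∈ S, g x = 0) ∧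
        ∃ (R : ℕ) (f : Fin R → Fin k → ℤ) (q : Fin R → (Fin n → ℝ) → ℝ)
          (S' : ℕ) (f' : Fin S' → Fin l → ℤ) (m : Fin S' → ℚ) (q' : Fin S' → (Fin n → ℝ) → ℝ),
          (∀ r, IsSemialgebraicFunOn ℚ S (q r)) ∧ (∀ r, ∀ x ∈ S, ∏ i, W i x ^ (f r i) = 1) ∧
          (∀ i, ∀ x ∈ S, h i x = ∑ r, q r x * (f r i : ℝ)) ∧
          (∀ s, IsSemialgebraicFunOn ℚ S (q' s)) ∧
          (∀ s, ∀ x ∈ S, ∑ j, (f' s j : ℝ) * Real.arctan (u j x) = (m s : ℝ) * Real.pi) ∧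
          (∀ x ∈ S, ∑ s, q' s x * (m s : ℝ) = 0) ∧
          (∀ j, ∀ x ∈ S, p j x = ∑ s, q' s x * (f' s j : ℝ))))
    (fun b c => ⟨(hC b c).1, (hC b c).2.1, hdata b c⟩)
  refine ⟨M, E, fun j => ⟨(hE j).2.1, (hE j).2.2.1, (hE j).1.trans hGU⟩, hEd, ?_, fun j => (hE j).2.2.2⟩
  exact measure_mono_null (fun x hx => by
    by_cases hxG : x ∈ G
    · exact Or.inr ⟨hxG, hx.2⟩
    · exact Or.inl ⟨hx.1, hxG⟩) (measure_union_null hUG hEn)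

/-! ### §20 The differentiated identity (descent step 3, every dimension) — PROVED -/

/-- **The differentiated identity** (descent step 3, every dimension, any direction `v`): on an open `U`, differentiating
`Σ hᵢ log Wᵢ + Σ pⱼ arctan uⱼ = g` along `v` gives
`Σ (∂ᵥhᵢ) log Wᵢ + Σ (∂ᵥpⱼ) arctan uⱼ = ∂ᵥg − Σ hᵢ ∂ᵥWᵢ / Wᵢ − Σ pⱼ ∂ᵥuⱼ / (1 + uⱼ²)` — an identity of the same shape with one
fewer term after a normalisation `h_{i₀} ≡ 1`, and with a right-hand side that is `ℚ`-sa when the data are (derivatives of sa functions are sa). -/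
theorem circle_identity_fderiv {n k l : ℕ} {U : Set (Fin n → ℝ)} (hUo : IsOpen U)
    {h W : Fin k → (Fin n → ℝ) → ℝ} {p u : Fin l → (Fin n → ℝ) → ℝ} {g : (Fin n → ℝ) → ℝ}
    (hhd : ∀ i, ∀ x ∈ U, DifferentiableAt ℝ (h i) x) (hWd : ∀ i, ∀ x ∈ U, DifferentiableAt ℝ (W i) x)
    (hW0 : ∀ i, ∀ x ∈ U, 0 < W i x)
    (hpd : ∀ j, ∀ x ∈ U, DifferentiableAt ℝ (p j) x) (hud : ∀ j, ∀ x ∈ U, DifferentiableAt ℝ (u j) x)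
    (hid : ∀ x ∈ U, ∑ i, h i x * Real.log (W i x) + ∑ j, p j x * Real.arctan (u j x) = g x)
    (v : Fin n → ℝ) :
    ∀ x ∈ U, ∑ i, fderiv ℝ (h i) x v * Real.log (W i x) + ∑ j, fderiv ℝ (p j) x v * Real.arctan (u j x) =
      fderiv ℝ g x v - ∑ i, h i x * (fderiv ℝ (W i) x v / W i x) -
        ∑ j, p j x * (fderiv ℝ (u j) x v / (1 + u j x ^ 2)) := by
  intro x hx
  -- the left-hand side function and its derivative at `x`
  set F : (Fin n → ℝ) → ℝ := fun y => ∑ i, h i y * Real.log (W i y) + ∑ j, p j y * Real.arctan (u j y) with hF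
  have hlog : ∀ i, HasFDerivAt (fun y => Real.log (W i y)) ((W i x)⁻¹ • fderiv ℝ (W i) x) x := fun i =>
    ((Real.hasDerivAt_log (hW0 i x hx).ne').comp_hasFDerivAt x (hWd i x hx).hasFDerivAt)
  have hatan : ∀ j, HasFDerivAt (fun y => Real.arctan (u j y)) ((1 / (1 + u j x ^ 2)) • fderiv ℝ (u j) x) x :=
    fun j => (Real.hasDerivAt_arctan (u j x)).comp_hasFDerivAt x (hud j x hx).hasFDerivAt
  have hF' : HasFDerivAt F
      (∑ i, (h i x • ((W i x)⁻¹ • fderiv ℝ (W i) x) + Real.log (W i x) • fderiv ℝ (h i) x) +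
        ∑ j, (p j x • ((1 / (1 + u j x ^ 2)) • fderiv ℝ (u j) x) + Real.arctan (u j x) • fderiv ℝ (p j) x)) x := by
    refine HasFDerivAt.add ?_ ?_
    · refine HasFDerivAt.fun_sum fun i _ => ?_
      have := (hhd i x hx).hasFDerivAt.mul (hlog i)
      exact this
    · refine HasFDerivAt.fun_sum fun j _ => ?_
      have := (hpd j x hx).hasFDerivAt.mul (hatan j)
      exact this
  -- `g` agrees with `F` near `x`
  have hgF : g =ᶠ[𝓝 x] F := by
    filter_upwards [hUo.mem_nhds hx] with y hy
    exact (hid y hy).symm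
  have hfd : fderiv ℝ g x = fderiv ℝ F x := hgF.fderiv_eq
  rw [hfd, hF'.fderiv]
  simp only [add_apply, FunLike.coe_sum, Finset.sum_apply, FunLike.coe_smul, Pi.smul_apply, smul_eq_mul]
  have e1 : ∀ i, h i x * ((W i x)⁻¹ * fderiv ℝ (W i) x v) = h i x * (fderiv ℝ (W i) x v / W i x) := fun i => by
    rw [div_eq_inv_mul]
  have e2 : ∀ j, p j x * (1 / (1 + u j x ^ 2) * fderiv ℝ (u j) x v) = p j x * (fderiv ℝ (u j) x v / (1 + u j x ^ 2)) :=
    fun j => by rw [one_div, div_eq_inv_mul]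
  simp only [Finset.sum_add_distrib, e1, e2]
  have e3 : ∑ i, Real.log (W i x) * fderiv ℝ (h i) x v = ∑ i, fderiv ℝ (h i) x v * Real.log (W i x) :=
    Finset.sum_congr rfl fun i _ => mul_comm _ _
  have e4 : ∑ j, Real.arctan (u j x) * fderiv ℝ (p j) x v = ∑ j, fderiv ℝ (p j) x v * Real.arctan (u j x) :=
    Finset.sum_congr rfl fun j _ => mul_comm _ _
  rw [e3, e4]
  ring

/-! ### §21 Elimination of one term by an EXACT relation (descent step 4(b), every `n`) — PROVED

Log version (`∏ W^{f₀} = 1`, `f₀ i₀ ≠ 0`) and angle version (`Σ f′₀ arctan u = 0`, `f′₀ j₀ ≠ 0`): the reduced identity, and the translation of the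
structure data of the reduced family back to the original one (append `f₀` with the sa coefficient `h_{i₀}/f₀_{i₀}`, resp. `f′₀`, `m = 0`, `p_{j₀}/f′₀_{j₀}`). -/

/-- **Elimination by an exact multiplicative relation — the identity** (descent step 4(b)): if `∏ Wᵢ^{f₀ᵢ} = 1` on `U` with
`f₀ i₀ ≠ 0`, the identity for `h` is equivalent to the identity for the reduced coefficients `h̃ᵢ = hᵢ − h_{i₀} f₀ᵢ / f₀_{i₀}`
(and `h̃_{i₀} = 0`). -/
theorem circle_identity_elimLog {n k l : ℕ} {U : Set (Fin n → ℝ)}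
    {h W : Fin k → (Fin n → ℝ) → ℝ} {p u : Fin l → (Fin n → ℝ) → ℝ} {g : (Fin n → ℝ) → ℝ}
    (hW0 : ∀ i, ∀ x ∈ U, 0 < W i x) (f₀ : Fin k → ℤ) (i₀ : Fin k)
    (hrel₀ : ∀ x ∈ U, ∏ i, W i x ^ (f₀ i) = 1)
    (hid : ∀ x ∈ U, ∑ i, h i x * Real.log (W i x) + ∑ j, p j x * Real.arctan (u j x) = g x) :
    ∀ x ∈ U, ∑ i, (h i x - h i₀ x * ((f₀ i : ℝ) / (f₀ i₀ : ℝ))) * Real.log (W i x) +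
      ∑ j, p j x * Real.arctan (u j x) = g x := by
  intro x hx
  have hlog : ∑ i, (f₀ i : ℝ) * Real.log (W i x) = 0 := by
    have h1 : Real.log (∏ i, W i x ^ (f₀ i)) = 0 := by rw [hrel₀ x hx, Real.log_one]
    rw [Real.log_prod (s := Finset.univ) (fun i _ => (zpow_pos (hW0 i x hx) _).ne')] at h1
    simpa [Real.log_zpow] using h1
  rw [← hid x hx]
  congr 1
  have : ∑ i, (h i x - h i₀ x * ((f₀ i : ℝ) / (f₀ i₀ : ℝ))) * Real.log (W i x) =
      ∑ i, h i x * Real.log (W i x) - h i₀ x / (f₀ i₀ : ℝ) * ∑ i, (f₀ i : ℝ) * Real.log (W i x) := by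
    rw [Finset.mul_sum, ← Finset.sum_sub_distrib]
    exact Finset.sum_congr rfl fun i _ => by ring
  rw [this, hlog, mul_zero, sub_zero]

/-- **Elimination by an exact multiplicative relation — translating the structure data back** (descent step 4(b), every `n`):
the structure conclusion for the reduced coefficients `h̃ᵢ = hᵢ − h_{i₀} f₀ᵢ / f₀_{i₀}` on `U` implies the conclusion for `h`
(append the relation `f₀` with the `ℚ`-sa coefficient `h_{i₀} / f₀_{i₀}` on every cell). -/
theorem circleLogStructure_elimLog {n k l : ℕ} {U : Set (Fin n → ℝ)}
    {h W : Fin k → (Fin n → ℝ) → ℝ} {p u : Fin l → (Fin n → ℝ) → ℝ} {g : (Fin n → ℝ) → ℝ}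
    (hh : ∀ i, IsSemialgebraicFunOn ℚ U (h i)) (f₀ : Fin k → ℤ) (i₀ : Fin k) (hf₀ : f₀ i₀ ≠ 0)
    (hrel₀ : ∀ x ∈ U, ∏ i, W i x ^ (f₀ i) = 1)
    (hred : ∃ (N : ℕ) (C : Fin N → Set (Fin n → ℝ)),
      (∀ c, IsSemialgebraic ℚ (C c) ∧ IsOpen (C c) ∧ C c ⊆ U) ∧
      Pairwise (Function.onFun Disjoint C) ∧ volume (U \ ⋃ c, C c) = 0 ∧
      ∀ c, (∀ x ∈ C c, g x = 0) ∧
        ∃ (R : ℕ) (f : Fin R → Fin k → ℤ) (q : Fin R → (Fin n → ℝ) → ℝ)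
          (S : ℕ) (f' : Fin S → Fin l → ℤ) (m : Fin S → ℚ) (q' : Fin S → (Fin n → ℝ) → ℝ),
          (∀ r, IsSemialgebraicFunOn ℚ (C c) (q r)) ∧ (∀ r, ∀ x ∈ C c, ∏ i, W i x ^ (f r i) = 1) ∧
          (∀ i, ∀ x ∈ C c, (h i x - h i₀ x * ((f₀ i : ℝ) / (f₀ i₀ : ℝ))) = ∑ r, q r x * (f r i : ℝ)) ∧
          (∀ s, IsSemialgebraicFunOn ℚ (C c) (q' s)) ∧
          (∀ s, ∀ x ∈ C c, ∑ j, (f' s j : ℝ) * Real.arctan (u j x) = (m s : ℝ) * Real.pi) ∧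
          (∀ x ∈ C c, ∑ s, q' s x * (m s : ℝ) = 0) ∧
          (∀ j, ∀ x ∈ C c, p j x = ∑ s, q' s x * (f' s j : ℝ))) :
    ∃ (N : ℕ) (C : Fin N → Set (Fin n → ℝ)),
      (∀ c, IsSemialgebraic ℚ (C c) ∧ IsOpen (C c) ∧ C c ⊆ U) ∧
      Pairwise (Function.onFun Disjoint C) ∧ volume (U \ ⋃ c, C c) = 0 ∧
      ∀ c, (∀ x ∈ C c, g x = 0) ∧
        ∃ (R : ℕ) (f : Fin R → Fin k → ℤ) (q : Fin R → (Fin n → ℝ) → ℝ)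
          (S : ℕ) (f' : Fin S → Fin l → ℤ) (m : Fin S → ℚ) (q' : Fin S → (Fin n → ℝ) → ℝ),
          (∀ r, IsSemialgebraicFunOn ℚ (C c) (q r)) ∧ (∀ r, ∀ x ∈ C c, ∏ i, W i x ^ (f r i) = 1) ∧
          (∀ i, ∀ x ∈ C c, h i x = ∑ r, q r x * (f r i : ℝ)) ∧
          (∀ s, IsSemialgebraicFunOn ℚ (C c) (q' s)) ∧
          (∀ s, ∀ x ∈ C c, ∑ j, (f' s j : ℝ) * Real.arctan (u j x) = (m s : ℝ) * Real.pi) ∧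
          (∀ x ∈ C c, ∑ s, q' s x * (m s : ℝ) = 0) ∧
          (∀ j, ∀ x ∈ C c, p j x = ∑ s, q' s x * (f' s j : ℝ)) := by
  classical
  obtain ⟨N, C, hC, hdisj, hnull, hcell⟩ := hred
  refine ⟨N, C, hC, hdisj, hnull, fun c₀ => ?_⟩
  obtain ⟨hg0, R, f, q, S, f', m, q', hq, hrel, hhq, hq', hrel', hbud, hpq⟩ := hcell c₀
  have hCU : C c₀ ⊆ U := (hC c₀).2.2
  -- the extra coefficient `h_{i₀} / f₀_{i₀}` is `ℚ`-sa on the cell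
  have hq₀ : IsSemialgebraicFunOn ℚ (C c₀) (fun x => h i₀ x / (f₀ i₀ : ℝ)) := by
    have h1 : IsSemialgebraicFunOn ℚ (C c₀) (h i₀) := (hh i₀).mono hCU (hC c₀).1
    have h2 : IsSemialgebraicFunOn ℚ (C c₀) (fun _ => ((f₀ i₀ : ℚ) : ℝ)) :=
      isSemialgebraicFunOn_const_ratCast (hC c₀).1 (f₀ i₀ : ℚ)
    have h3 := h1.div h2 (fun x _ => by exact_mod_cast hf₀)
    exact h3.congr fun x _ => by push_cast; rfl
  refine ⟨hg0, R + 1, Fin.snoc f f₀, Fin.snoc q (fun x => h i₀ x / (f₀ i₀ : ℝ)), S, f', m, q', ?_, ?_, ?_, hq',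
    hrel', hbud, hpq⟩
  · intro r
    refine Fin.lastCases ?_ (fun r' => ?_) r
    · simpa only [Fin.snoc_last] using hq₀
    · simpa only [Fin.snoc_castSucc] using hq r'
  · intro r x hx
    refine Fin.lastCases ?_ (fun r' => ?_) r
    · simpa only [Fin.snoc_last] using hrel₀ x (hCU hx)
    · simpa only [Fin.snoc_castSucc] using hrel r' x hx
  · intro i x hx
    rw [Fin.sum_univ_castSucc]
    simp only [Fin.snoc_castSucc, Fin.snoc_last]
    have e := hhq i x hx
    have hf0 : (f₀ i₀ : ℝ) ≠ 0 := by exact_mod_cast hf₀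
    have : h i x = ∑ r, q r x * (f r i : ℝ) + h i₀ x * ((f₀ i : ℝ) / (f₀ i₀ : ℝ)) := by rw [← e]; ring
    rw [this]
    congr 1
    field_simp

/-- **Elimination by an exact angle relation — the identity**: if `Σ f′₀ⱼ arctan uⱼ = 0` on `U`, the identity for `p` is equivalent to
the identity for the reduced coefficients `p̃ⱼ = pⱼ − p_{j₀} f′₀ⱼ / f′₀_{j₀}`. -/
theorem circle_identity_elimAngle {n k l : ℕ} {U : Set (Fin n → ℝ)}
    {h W : Fin k → (Fin n → ℝ) → ℝ} {p u : Fin l → (Fin n → ℝ) → ℝ} {g : (Fin n → ℝ) → ℝ}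
    (f₀ : Fin l → ℤ) (j₀ : Fin l)
    (hrel₀ : ∀ x ∈ U, ∑ j, (f₀ j : ℝ) * Real.arctan (u j x) = 0)
    (hid : ∀ x ∈ U, ∑ i, h i x * Real.log (W i x) + ∑ j, p j x * Real.arctan (u j x) = g x) :
    ∀ x ∈ U, ∑ i, h i x * Real.log (W i x) +
      ∑ j, (p j x - p j₀ x * ((f₀ j : ℝ) / (f₀ j₀ : ℝ))) * Real.arctan (u j x) = g x := by
  intro x hx
  rw [← hid x hx]
  congr 1
  have : ∑ j, (p j x - p j₀ x * ((f₀ j : ℝ) / (f₀ j₀ : ℝ))) * Real.arctan (u j x) =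
      ∑ j, p j x * Real.arctan (u j x) - p j₀ x / (f₀ j₀ : ℝ) * ∑ j, (f₀ j : ℝ) * Real.arctan (u j x) := by
    rw [Finset.mul_sum, ← Finset.sum_sub_distrib]
    exact Finset.sum_congr rfl fun j _ => by ring
  rw [this, hrel₀ x hx, mul_zero, sub_zero]

end G13
end Summit.KontsevichZagierPeriods.RootDecompRelativeModAbsolute.Rung30571.RegularisedLogLayer.CylLog.Leaf
end
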